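import Summits.QuantumFields.YangMills.Theorems.UnitScaleTiltProp7TwistedSliceTangent
import Summits.QuantumFields.YangMills.Theorems.UnitScaleTiltProp7FibreELOfCritSplit
import Summits.QuantumFields.YangMills.Theorems.UnitScaleTiltProp7ChartVelocitySU2
import HarnessLib

/-!
# Route `UnitScaleTilt`, crux «MinimiserStabilityRegPr» (stmt-QuantumFields-19200, stub EX `stub_existenceMinimalOrbit`, route (α)) — «SLICE-TANGENT-OF-KER-QTWS» (first half of the bridge
# `hSplit′ ⟹ hSplit127` for ✓`Prop7Crit127OfCrit93Split.hCrit127_of_hCrit93_of_split127`, ★px16 g3 LOCATE-H128-FAMILY (L1)): **A `ker QTwS(U₀)` DIRECTION OF THE EXPONENT-UNITS CHART IS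
# TANGENT TO THE TWISTED SLICE AT THE CHART VALUE** — for `δ` with `QTwS U₀ δ = 0` and any Fréchet derivative `D` of `χ(A) = A − H·Dfix(CmapTwS U₀) H C₂ A` at `A′`:
# `D(logChartTwS U₀)(χ A′)(Dδ) = 0` ((48)-twS ✓`logChartTwS_eq_QTwS_of_chart47twS` + chain rule + (AN) ✓`analyticOnNhd_logChartTwS`); and `Dδ` is `𝔰𝔲(2)`-valued for real `δ` ((51) along the ray,
# closedness of `𝔰𝔲(2)`), hence so is its chart velocity `g(ad(−χ(A′)))(Dδ)` (✓`Prop7ChartVelocitySU2`).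

Cell `ym3-torus` (HUMAN RULING D-0037, YM ladder rung R3 — YM₃ on T³, NOT d = 4, NOT Clay; YM gap NOT proved), width seat `ym3-torus-px21` gen 3 (explicit-unit helper; lineage px21 g0∕g2∕g3:
✓p650826 is this seat's door).  THEOREMS ONLY (0 `def`, 0 `sorry`); `--supports stmt-QuantumFields-19200 --as helper`, count-neutral; NO claim on crux ∕ stub ∕ registry.

THE PRINT.  [Balaban1985Variational] p. 296–297 (123)–(126): «configurations with f ≠ 0 can be obtained from configurations with f = 0 … by gauge transformations … each submanifold … contained in an
orbit of the group of gauge transformations»; (47)–(49) p. 285 (the chart `A = A′ − HD(A′)` with `C(A) = D(A′)`, i.e. (48) «the average of the chart point is `QA′`»); (51) p. 286 (reality).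
In the tree the fibre is cut, in `U₀`'s exponential chart, by the TWISTED log-average `logChartTwS U₀` (✓`Prop7SymAvgTwSym`), and (48)-twS reads `logChartTwS U₀ (χ A″) = QTwS U₀ A″` on the chart
ball; so along `A′ + tδ` with `QTwS δ = 0` the twisted log-average is constant, and the chart differential sends `δ` into the tangent space of the twisted slice at `A₁ := χ(A′)` — the input of
T2 ✓`Prop7TwistedSliceTangent.fderiv_logChartTwS_apply_eq_zero_iff_of_regPr` (which then says `QSym(U′)` of the velocity is the coarse gauge motion of the frame response — the second half).
WHAT IS PROVED (member `F`, `K n`, `h : n ≤ K`; ns `…Theorems.Prop7SliceTangentOfKerQTwS`):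
* §1 `isClosed_skewTraceless` (the `𝔰𝔲(2)`-valued bond fields form a closed set), ★★`skew_traceless_of_hasFDerivAt_of_eventually_real` — if `χ` maps the real (skew-Hermitian-traceless) fields
  near `A′` to real fields and `HasFDerivAt χ D A′`, then `Dδ` is real for real `A′`, `δ` (limit of real difference quotients).
* §2 ★★★`fderiv_logChartTwS_chart_apply_eq_zero_of_QTwS_eq_zero` — in p650826's letters (`U₀ ∈ 𝔘_k(ε₀)`, `10⁹L²e ≤ 1`, `10¹²L³ε₀ ≤ 1`, `‖HY‖ ≤ b‖Y‖`, `9C₂ˢbε < 1`, `6ε ≤ e·η`,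
  `Q(U₀)∘H = id`, `2‖A′‖ < ε`): `QTwS U₀ δ = 0 → HasFDerivAt χ D A′ → fderiv ℂ (logChartTwS U₀) (χ A′) (D δ) = 0`.
* §3 ★★`skew_traceless_fderiv_chart_apply` (`Dδ` real for real `A′`, `δ`, by §1 + (51) ✓`isHermitian_trace_zero_chartTwS`) and ★★`skew_traceless_velocity` (`g(ad(−χ(A′)b))((Dδ)b)` real,
  ✓`star_gSer_ad_apply_of_skew`, ✓`trace_gSer_ad_apply`).
HONEST SCOPE.  Calculus over landed letters (Prop. 3-twS, (48)-twS, (AN), (51)); no estimate; the second half of the bridge (frame-response gauge correction + the display's `hSplit′`) is NOT here;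
not a proof of any stub; nothing continuum ∕ OS ∕ mass-gap ∕ Clay.
-/

set_option autoImplicit false

noncomputable section

open scoped Matrix.Norms.L2Operator Matrix Topology
open Filter Metric NormedSpace

namespace Summit.QuantumFields.YangMills.Theorems.Prop7SliceTangentOfKerQTwS

open Literature.Analysis.Calculus.ExpDifferential (ad gSer)
open Literature.MathematicalPhysics.QuantumFieldTheory.Balaban1983to89
open Literature.MathematicalPhysics.QuantumFieldTheory.Balaban1983to89.T3ContinuumYM3Torus
open T3PrintedRegularMinimiser (RegPr)
open T3SectALandauChart (eta eta_pos)
open B11Prop3Model (Dfix)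
open Summit.QuantumFields.YangMills.Theorems.Prop7SymAvgTwSym (logChartTwS QTwS CmapTwS Chart47T3twS logChartTwS_eq_QTwS_of_chart47twS)
open Summit.QuantumFields.YangMills.Theorems.Prop7CmapTwSymInputs (analyticOnNhd_logChartTwS chart47twS_of_regPr)
open Summit.QuantumFields.YangMills.Theorems.Prop7FibreELOfCritSplit (isHermitian_trace_zero_chartTwS skew_add_real_smul)
open Summit.QuantumFields.YangMills.Theorems.Prop7ChartVelocitySU2 (star_gSer_ad_apply_of_skew trace_gSer_ad_apply)

variable (F : T3Family) {n K : ℕ} (h : n ≤ K) [Fact (0 < (F.L : ℝ))] [Fact (0 < ((F.L : ℝ)⁻¹) ^ (K - n))]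

/-! ## §1 Derivatives of real-preserving maps along real directions are real -/

omit [Fact (0 < (F.L : ℝ))] [Fact (0 < ((F.L : ℝ)⁻¹) ^ (K - n))] in
/-- The `𝔰𝔲(2)`-valued bond fields (`star (f b) = −f b`, `tr (f b) = 0` for every bond) form a CLOSED set. [folklore] -/
theorem isClosed_skewTraceless :
    IsClosed {f : PBond (F.P K) 0 → Matrix (Fin 2) (Fin 2) ℂ | ∀ b, star (f b) = -f b ∧ (f b).trace = 0} := by
  have h1 : {f : PBond (F.P K) 0 → Matrix (Fin 2) (Fin 2) ℂ | ∀ b, star (f b) = -f b ∧ (f b).trace = 0}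
      = ⋂ b, ({f | star (f b) = -f b} ∩ {f | (f b).trace = 0}) := by
    ext f
    simp only [Set.mem_setOf_eq, Set.mem_iInter, Set.mem_inter_iff]
  rw [h1]
  refine isClosed_iInter fun b => IsClosed.inter ?_ ?_
  · exact isClosed_eq ((continuous_star.comp (continuous_apply b))) ((continuous_apply b).neg)
  · exact isClosed_eq ((Matrix.traceLinearMap (Fin 2) ℂ ℂ).continuous_of_finiteDimensional.comp (continuous_apply b)) continuous_const

omit [Fact (0 < (F.L : ℝ))] [Fact (0 < ((F.L : ℝ)⁻¹) ^ (K - n))] in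
/-- ★★ **A DERIVATIVE OF A REAL-PRESERVING MAP ALONG A REAL DIRECTION IS REAL**: if `χ` maps the `𝔰𝔲(2)`-valued fields in a neighbourhood of `A′` to `𝔰𝔲(2)`-valued fields, `HasFDerivAt χ D A′`,
and `A′`, `δ` are `𝔰𝔲(2)`-valued, then so is `Dδ` (the real difference quotients `t⁻¹(χ(A′ + tδ) − χ(A′))` converge to `Dδ` in a closed real subspace). [folklore] -/
theorem skew_traceless_of_hasFDerivAt_of_eventually_real
    {χ : (PBond (F.P K) 0 → Matrix (Fin 2) (Fin 2) ℂ) → (PBond (F.P K) 0 → Matrix (Fin 2) (Fin 2) ℂ)}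
    {D : (PBond (F.P K) 0 → Matrix (Fin 2) (Fin 2) ℂ) →L[ℂ] (PBond (F.P K) 0 → Matrix (Fin 2) (Fin 2) ℂ)} {A' δ : PBond (F.P K) 0 → Matrix (Fin 2) (Fin 2) ℂ}
    (hD : HasFDerivAt χ D A')
    (hχ : ∀ᶠ A in 𝓝 A', (∀ b, star (A b) = -A b ∧ (A b).trace = 0) → ∀ b, star (χ A b) = -χ A b ∧ (χ A b).trace = 0)
    (hA' : ∀ b, star (A' b) = -A' b ∧ (A' b).trace = 0) (hδ : ∀ b, star (δ b) = -δ b ∧ (δ b).trace = 0) :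
    ∀ b, star (D δ b) = -(D δ b) ∧ (D δ b).trace = 0 := by
  -- the derivative along the real line `t ↦ A′ + tδ`
  have hline : HasDerivAt (fun t : ℝ => A' + (t : ℂ) • δ) δ 0 := by
    have h1 := ((Complex.ofRealCLM.hasDerivAt (x := (0 : ℝ))).smul_const δ).const_add A'
    simpa only [Complex.ofRealCLM_apply, Complex.ofReal_one, one_smul] using h1
  have hcomp : HasDerivAt (fun t : ℝ => χ (A' + (t : ℂ) • δ)) (D δ) 0 := by
    have h0 : A' = (fun t : ℝ => A' + (t : ℂ) • δ) 0 := by simp only [Complex.ofReal_zero, zero_smul, add_zero]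
    have h1 := (hD.restrictScalars ℝ).comp_hasDerivAt_of_eq (0 : ℝ) hline h0
    simpa only [Function.comp_def, ContinuousLinearMap.coe_restrictScalars'] using h1
  -- the difference quotients are real, eventually
  have hslope := hcomp.tendsto_slope_zero
  have hreal : ∀ᶠ t : ℝ in 𝓝[≠] 0, (t⁻¹ • (χ (A' + (((0 : ℝ) + t : ℝ) : ℂ) • δ) - χ (A' + (((0 : ℝ)) : ℂ) • δ)))
      ∈ {f : PBond (F.P K) 0 → Matrix (Fin 2) (Fin 2) ℂ | ∀ b, star (f b) = -f b ∧ (f b).trace = 0} := by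
    have hcont : ContinuousAt (fun t : ℝ => A' + (t : ℂ) • δ) 0 := hline.continuousAt
    have hev : ∀ᶠ t : ℝ in 𝓝 0, (∀ b, star ((A' + (t : ℂ) • δ) b) = -(A' + (t : ℂ) • δ) b ∧ ((A' + (t : ℂ) • δ) b).trace = 0) →
        ∀ b, star (χ (A' + (t : ℂ) • δ) b) = -χ (A' + (t : ℂ) • δ) b ∧ (χ (A' + (t : ℂ) • δ) b).trace = 0 := by
      have h1 := hcont.eventually (show ∀ᶠ A in 𝓝 ((fun t : ℝ => A' + (t : ℂ) • δ) 0), _ from by simpa only [Complex.ofReal_zero, zero_smul, add_zero] using hχ)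
      exact h1
    have hev' : ∀ᶠ t : ℝ in 𝓝[≠] 0, (∀ b, star (χ (A' + (t : ℂ) • δ) b) = -χ (A' + (t : ℂ) • δ) b ∧ (χ (A' + (t : ℂ) • δ) b).trace = 0) :=
      nhdsWithin_le_nhds (hev.mono fun t ht => ht (skew_add_real_smul hA' hδ t))
    have h0 : ∀ b, star (χ A' b) = -χ A' b ∧ (χ A' b).trace = 0 := hχ.self_of_nhds hA'
    filter_upwards [hev'] with t ht
    simp only [zero_add, Complex.ofReal_zero, zero_smul, add_zero]
    intro b
    refine ⟨?_, ?_⟩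
    · rw [Pi.smul_apply, Pi.sub_apply, star_smul, star_trivial, star_sub, (ht b).1, (h0 b).1, smul_sub, smul_sub, smul_neg, smul_neg]
      abel
    · rw [Pi.smul_apply, Pi.sub_apply, Matrix.trace_smul, Matrix.trace_sub, (ht b).2, (h0 b).2, sub_zero, smul_zero]
  exact (isClosed_skewTraceless F).mem_of_tendsto hslope hreal

/-! ## §2 ★★★ A `ker QTwS(U₀)` chart direction is tangent to the twisted slice at the chart value -/

omit [Fact (0 < (F.L : ℝ))] [Fact (0 < ((F.L : ℝ)⁻¹) ^ (K - n))] in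
/-- ★★★ **`QTwS U₀ δ = 0 ⟹ D(logChartTwS U₀)(χ A′)(Dδ) = 0`** — in the letters of ✓`hCrit127_of_hCrit93_of_split127` (`χ A = A − H·Dfix(CmapTwS U₀) H C₂ˢ A`, `C₂ˢ = 40M₀ˢ∕(e·η)²`; window
`U₀ ∈ 𝔘_k(ε₀)`, `10⁹L²e ≤ 1`, `10¹²L³ε₀ ≤ 1`, `‖HY‖ ≤ b‖Y‖`, `9C₂ˢbε < 1`, `6ε ≤ e·η`; `Q(U₀)∘H = id`; `2‖A′‖ < ε`), for ANY Fréchet derivative `D` of `χ` at `A′`: along `A′ + tδ` the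
twisted log-average of the chart point is `QTwS(A′ + tδ) = QTwS A′` ((48)-twS), so by the chain rule at the analytic point `χ A′` (‖χ A′‖ < 2ε ≤ e·η∕3) the slice differential kills `Dδ`.
[cite: Balaban1985Variational, (47)–(49) p.285, (123)–(126) pp.296–297, Prop. 3 p.289; Balaban1985BackgroundPropagators, (3.13)–(3.14) p.393] -/
theorem fderiv_logChartTwS_chart_apply_eq_zero_of_QTwS_eq_zero {ε₀ e b ε : ℝ} (hε₀ : 0 < ε₀) (he : 0 < e) (hWe : 10 ^ 9 * (F.L : ℝ) ^ 2 * e ≤ 1)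
    (hWε : 10 ^ 12 * (F.L : ℝ) ^ 3 * ε₀ ≤ 1) (U₀ : GaugeField (F.P K) 0 (Matrix.specialUnitaryGroup (Fin 2) ℂ)) (hreg : RegPr F n K ε₀ U₀)
    {H : (PBond (F.P n) 0 → Matrix (Fin 2) (Fin 2) ℂ) →ₗ[ℂ] (PBond (F.P K) 0 → Matrix (Fin 2) (Fin 2) ℂ)} (hb : 0 ≤ b) (hHop : ∀ Y, ‖H Y‖ ≤ b * ‖Y‖)
    (hq : 9 * (40 * (2 * (3 * (2 * e + 2700 * (F.L : ℝ) * ε₀))) / (e * eta F n K) ^ 2) * b * ε < 1) (hRε : 6 * ε ≤ e * eta F n K)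
    (hQH : ∀ Y, QTwS F n K h U₀ (H Y) = Y)
    {A' : PBond (F.P K) 0 → Matrix (Fin 2) (Fin 2) ℂ} (hA'ε : 2 * ‖A'‖ < ε)
    {D : (PBond (F.P K) 0 → Matrix (Fin 2) (Fin 2) ℂ) →L[ℂ] (PBond (F.P K) 0 → Matrix (Fin 2) (Fin 2) ℂ)}
    (hD : HasFDerivAt (fun A : PBond (F.P K) 0 → Matrix (Fin 2) (Fin 2) ℂ =>
      A - H (Dfix (CmapTwS F n K h U₀) H (40 * (2 * (3 * (2 * e + 2700 * (F.L : ℝ) * ε₀))) / (e * eta F n K) ^ 2) A)) D A')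
    {δ : PBond (F.P K) 0 → Matrix (Fin 2) (Fin 2) ℂ} (hδQ : QTwS F n K h U₀ δ = 0) :
    fderiv ℂ (logChartTwS F n K h U₀)
        (A' - H (Dfix (CmapTwS F n K h U₀) H (40 * (2 * (3 * (2 * e + 2700 * (F.L : ℝ) * ε₀))) / (e * eta F n K) ^ 2) A')) (D δ) = 0 := by
  set C₂ : ℝ := 40 * (2 * (3 * (2 * e + 2700 * (F.L : ℝ) * ε₀))) / (e * eta F n K) ^ 2 with hC₂
  set χ : (PBond (F.P K) 0 → Matrix (Fin 2) (Fin 2) ℂ) → (PBond (F.P K) 0 → Matrix (Fin 2) (Fin 2) ℂ) :=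
    fun A => A - H (Dfix (CmapTwS F n K h U₀) H C₂ A) with hχ
  have h47 : Chart47T3twS F n K h C₂ ε U₀ H := chart47twS_of_regPr F h hε₀ he hWe hWε U₀ hreg hb hHop hq hRε
  have hA'1 : ‖A'‖ < ε := by nlinarith [norm_nonneg A']
  -- the chart value lies in the analyticity ball of the twisted log-chart
  have hA₁ : ‖χ A'‖ < e * eta F n K := by
    have h2 : ‖χ A'‖ < 2 * ε := h47.2.2.1 A' hA'1
    linarith [norm_nonneg A']
  have hL : HasFDerivAt (logChartTwS F n K h U₀) (fderiv ℂ (logChartTwS F n K h U₀) (χ A')) (χ A') :=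
    ((analyticOnNhd_logChartTwS F h hε₀ he hWe hWε U₀ hreg) (χ A') (mem_ball_zero_iff.2 hA₁)).differentiableAt.hasFDerivAt
  have hcomp : HasFDerivAt ((logChartTwS F n K h U₀) ∘ χ) ((fderiv ℂ (logChartTwS F n K h U₀) (χ A')).comp D) A' := hL.comp A' hD
  -- (48)-twS near `A′`: the composite IS `QTwS U₀`
  have h48 : ((logChartTwS F n K h U₀) ∘ χ) =ᶠ[𝓝 A'] fun A => QTwS F n K h U₀ A := by
    filter_upwards [isOpen_ball.mem_nhds (mem_ball_zero_iff.2 hA'1)] with A hA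
    exact logChartTwS_eq_QTwS_of_chart47twS h47 hQH A (mem_ball_zero_iff.1 hA)
  have hQ : HasFDerivAt ((logChartTwS F n K h U₀) ∘ χ) (QTwS F n K h U₀) A' :=
    ((QTwS F n K h U₀).hasFDerivAt).congr_of_eventuallyEq h48
  have huniq : (fderiv ℂ (logChartTwS F n K h U₀) (χ A')).comp D = QTwS F n K h U₀ := hcomp.unique hQ
  have happ := congrArg (fun T : (PBond (F.P K) 0 → Matrix (Fin 2) (Fin 2) ℂ) →L[ℂ] (PBond (F.P n) 0 → Matrix (Fin 2) (Fin 2) ℂ) => T δ) huniq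
  simp only [ContinuousLinearMap.coe_comp, Function.comp_apply, hδQ] at happ
  exact happ

/-! ## §3 Reality of the chart differential and of the chart velocity on real directions -/

/-- ★★ **`Dδ` IS `𝔰𝔲(2)`-VALUED FOR REAL `A′`, `δ`** (same window; `H` real; (51) ✓`isHermitian_trace_zero_chartTwS` on the ball `‖A″‖ < ε` ∋ `A′` + §1).
[cite: Balaban1985Variational, (51) p.286, (47) p.285] -/
theorem skew_traceless_fderiv_chart_apply {ε₀ e b ε : ℝ} (hε₀ : 0 < ε₀) (he : 0 < e) (hWe : 10 ^ 9 * (F.L : ℝ) ^ 2 * e ≤ 1)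
    (hWε : 10 ^ 12 * (F.L : ℝ) ^ 3 * ε₀ ≤ 1) (U₀ : GaugeField (F.P K) 0 (Matrix.specialUnitaryGroup (Fin 2) ℂ)) (hreg : RegPr F n K ε₀ U₀)
    {H : (PBond (F.P n) 0 → Matrix (Fin 2) (Fin 2) ℂ) →ₗ[ℂ] (PBond (F.P K) 0 → Matrix (Fin 2) (Fin 2) ℂ)} (hb : 0 ≤ b) (hHop : ∀ Y, ‖H Y‖ ≤ b * ‖Y‖)
    (hHR : ∀ Y : PBond (F.P n) 0 → Matrix (Fin 2) (Fin 2) ℂ, (∀ c, star (Y c) = -Y c ∧ (Y c).trace = 0) → ∀ b', star (H Y b') = -H Y b' ∧ (H Y b').trace = 0)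
    (hq : 9 * (40 * (2 * (3 * (2 * e + 2700 * (F.L : ℝ) * ε₀))) / (e * eta F n K) ^ 2) * b * ε < 1) (hRε : 6 * ε ≤ e * eta F n K)
    {A' : PBond (F.P K) 0 → Matrix (Fin 2) (Fin 2) ℂ} (hA'ε : 2 * ‖A'‖ < ε) (hA'R : ∀ b', star (A' b') = -A' b' ∧ (A' b').trace = 0)
    {D : (PBond (F.P K) 0 → Matrix (Fin 2) (Fin 2) ℂ) →L[ℂ] (PBond (F.P K) 0 → Matrix (Fin 2) (Fin 2) ℂ)}
    (hD : HasFDerivAt (fun A : PBond (F.P K) 0 → Matrix (Fin 2) (Fin 2) ℂ =>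
      A - H (Dfix (CmapTwS F n K h U₀) H (40 * (2 * (3 * (2 * e + 2700 * (F.L : ℝ) * ε₀))) / (e * eta F n K) ^ 2) A)) D A')
    {δ : PBond (F.P K) 0 → Matrix (Fin 2) (Fin 2) ℂ} (hδR : ∀ b', star (δ b') = -δ b' ∧ (δ b').trace = 0) :
    ∀ b', star (D δ b') = -(D δ b') ∧ (D δ b').trace = 0 := by
  have hA'1 : ‖A'‖ < ε := by nlinarith [norm_nonneg A']
  refine skew_traceless_of_hasFDerivAt_of_eventually_real F hD ?_ hA'R hδR
  filter_upwards [isOpen_ball.mem_nhds (mem_ball_zero_iff.2 hA'1)] with A hA hAR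
  intro b'
  have h51 := isHermitian_trace_zero_chartTwS F h hε₀ he hWe hWε U₀ hreg hb hHop hHR hq hRε (mem_ball_zero_iff.1 hA) hAR b'
  -- `(−I)•Y` Hermitian traceless ⟺ `Y` skew-Hermitian traceless
  set Y : Matrix (Fin 2) (Fin 2) ℂ := (A - H (Dfix (CmapTwS F n K h U₀) H (40 * (2 * (3 * (2 * e + 2700 * (F.L : ℝ) * ε₀))) / (e * eta F n K) ^ 2) A)) b' with hY
  have h51' : ((-Complex.I) • Y).IsHermitian ∧ ((-Complex.I) • Y).trace = 0 := by simpa only [Pi.smul_apply] using h51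
  obtain ⟨hH, htr⟩ := h51'
  have hYI : Y = Complex.I • ((-Complex.I) • Y) := by rw [smul_smul, mul_neg, Complex.I_mul_I, neg_neg, one_smul]
  refine ⟨?_, ?_⟩
  · rw [hYI, star_smul, Complex.star_def, Complex.conj_I, Matrix.star_eq_conjTranspose, hH.eq, neg_smul]
  · rw [hYI, Matrix.trace_smul, htr, smul_zero]

/-- ★★ **THE CHART VELOCITY OF A REAL `ker`-DIRECTION IS `𝔰𝔲(2)`-VALUED**: `b ↦ g(ad(−χ(A′)(b)))((Dδ)(b))` is skew-Hermitian traceless (§3 + ✓`star_gSer_ad_apply_of_skew` + ✓`trace_gSer_ad_apply`;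
`χ(A′) = iX` skew-Hermitian). [cite: Balaban1985Variational, (51) p.286; Balaban1985Averaging, (32)–(34) pp.22–23] -/
theorem skew_traceless_velocity {ε₀ e b ε : ℝ} (hε₀ : 0 < ε₀) (he : 0 < e) (hWe : 10 ^ 9 * (F.L : ℝ) ^ 2 * e ≤ 1)
    (hWε : 10 ^ 12 * (F.L : ℝ) ^ 3 * ε₀ ≤ 1) (U₀ : GaugeField (F.P K) 0 (Matrix.specialUnitaryGroup (Fin 2) ℂ)) (hreg : RegPr F n K ε₀ U₀)
    {H : (PBond (F.P n) 0 → Matrix (Fin 2) (Fin 2) ℂ) →ₗ[ℂ] (PBond (F.P K) 0 → Matrix (Fin 2) (Fin 2) ℂ)} (hb : 0 ≤ b) (hHop : ∀ Y, ‖H Y‖ ≤ b * ‖Y‖)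
    (hHR : ∀ Y : PBond (F.P n) 0 → Matrix (Fin 2) (Fin 2) ℂ, (∀ c, star (Y c) = -Y c ∧ (Y c).trace = 0) → ∀ b', star (H Y b') = -H Y b' ∧ (H Y b').trace = 0)
    (hq : 9 * (40 * (2 * (3 * (2 * e + 2700 * (F.L : ℝ) * ε₀))) / (e * eta F n K) ^ 2) * b * ε < 1) (hRε : 6 * ε ≤ e * eta F n K)
    {A' : PBond (F.P K) 0 → Matrix (Fin 2) (Fin 2) ℂ} (hA'ε : 2 * ‖A'‖ < ε) (hA'R : ∀ b', star (A' b') = -A' b' ∧ (A' b').trace = 0)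
    {X : PBond (F.P K) 0 → Matrix (Fin 2) (Fin 2) ℂ} (hX : ∀ b, (X b).IsHermitian ∧ (X b).trace = 0)
    (hAX : A' - H (Dfix (CmapTwS F n K h U₀) H (40 * (2 * (3 * (2 * e + 2700 * (F.L : ℝ) * ε₀))) / (e * eta F n K) ^ 2) A') = fun b' => Complex.I • X b')
    {D : (PBond (F.P K) 0 → Matrix (Fin 2) (Fin 2) ℂ) →L[ℂ] (PBond (F.P K) 0 → Matrix (Fin 2) (Fin 2) ℂ)}
    (hD : HasFDerivAt (fun A : PBond (F.P K) 0 → Matrix (Fin 2) (Fin 2) ℂ =>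
      A - H (Dfix (CmapTwS F n K h U₀) H (40 * (2 * (3 * (2 * e + 2700 * (F.L : ℝ) * ε₀))) / (e * eta F n K) ^ 2) A)) D A')
    {δ : PBond (F.P K) 0 → Matrix (Fin 2) (Fin 2) ℂ} (hδR : ∀ b', star (δ b') = -δ b' ∧ (δ b').trace = 0) :
    ∀ b', star (gSer ℂ (ad ℂ (-(A' - H (Dfix (CmapTwS F n K h U₀) H (40 * (2 * (3 * (2 * e + 2700 * (F.L : ℝ) * ε₀))) / (e * eta F n K) ^ 2) A')) b')) ((D δ) b'))
        = -(gSer ℂ (ad ℂ (-(A' - H (Dfix (CmapTwS F n K h U₀) H (40 * (2 * (3 * (2 * e + 2700 * (F.L : ℝ) * ε₀))) / (e * eta F n K) ^ 2) A')) b')) ((D δ) b')) ∧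
      (gSer ℂ (ad ℂ (-(A' - H (Dfix (CmapTwS F n K h U₀) H (40 * (2 * (3 * (2 * e + 2700 * (F.L : ℝ) * ε₀))) / (e * eta F n K) ^ 2) A')) b')) ((D δ) b')).trace = 0 := by
  intro b'
  have hDδ := skew_traceless_fderiv_chart_apply F h hε₀ he hWe hWε U₀ hreg hb hHop hHR hq hRε hA'ε hA'R hD hδR b'
  have hχb : (A' - H (Dfix (CmapTwS F n K h U₀) H (40 * (2 * (3 * (2 * e + 2700 * (F.L : ℝ) * ε₀))) / (e * eta F n K) ^ 2) A')) b' = Complex.I • X b' := by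
    rw [hAX]
  have hA₁ : star (-(A' - H (Dfix (CmapTwS F n K h U₀) H (40 * (2 * (3 * (2 * e + 2700 * (F.L : ℝ) * ε₀))) / (e * eta F n K) ^ 2) A')) b')
      = -(-(A' - H (Dfix (CmapTwS F n K h U₀) H (40 * (2 * (3 * (2 * e + 2700 * (F.L : ℝ) * ε₀))) / (e * eta F n K) ^ 2) A')) b') := by
    rw [hχb, star_neg, star_smul, Complex.star_def, Complex.conj_I, Matrix.star_eq_conjTranspose, (hX b').1.eq, neg_smul]
  exact ⟨star_gSer_ad_apply_of_skew hA₁ hDδ.1, trace_gSer_ad_apply _ _ hDδ.2⟩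

end Summit.QuantumFields.YangMills.Theorems.Prop7SliceTangentOfKerQTwS

end
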